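import Summits.NavierStokesRegularity.NavierStokesRegularity.Theorems.TautCompressionIntegrable.Negative.TautLoopSpaceTools
import Literature.Analysis.FluidPDE.VorticityCalculus
import Literature.Analysis.FluidPDE.VectorCalculusProofs

/-!
# The swirl–strain profile `V_δ` (negative side of `TautCompressionIntegrable`), part 2/4

The explicit smooth, compactly supported, divergence-free profile of the kinematic witness against
`TautCompressionIntegrable` without the momentum equation: `V_δ = v_sw + δ·w` with the unit-circle swirl
`v_sw = f J x`, `f = e^{(1−ρ²)/2} χ₁(ρ²) β₀(x₂)` (so `|v_sw| ≤ 1` with equality tangentially on the unit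
circle, `div v_sw = Df[Jx] = 0`), and the localised Burgers strain `w = curl(χ_b Ψ₀)`,
`Ψ₀ = (−x₁x₂, x₀x₂, 0)`, `curl Ψ₀ = ∇φ = S x = (−x₀, −x₁, 2x₂)` on the ball `‖x‖ < 4`, where the
residual `m = w − ∇(χ_b φ)` vanishes. Theorems and explicit objects only.
-/

noncomputable section

namespace Summit.NavierStokesRegularity.NavierStokesRegularity.Theorems.TautCompressionIntegrable.Negative

open MeasureTheory Set Filter Metric Real intervalIntegral InnerProductSpace
open scoped ENNReal RealInnerProductSpace ContDiff Topology
open Literature.Analysis.FluidPDE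

set_option linter.dupNamespace false

local notation "ℝ³" => EuclideanSpace ℝ (Fin 3)

/-! ## The profile: a unit-circle swirl plus a localised Burgers strain -/

/-- Cut-off of the radial profile about `ρ² = 1`: `1` on `[1/2, 3/2]`, `0` off `(1/4, 7/4)`. -/
def χ1 : ContDiffBump (1 : ℝ) := ⟨1 / 2, 3 / 4, by norm_num, by norm_num⟩

/-- Vertical cut-off: `1` on `[-1, 1]`, `0` off `(-2, 2)`. -/
def β0 : ContDiffBump (0 : ℝ) := ⟨1, 2, one_pos, one_lt_two⟩

/-- Localiser of the strain: `1` on `B̄(0, 4)`, `0` off `B(0, 5)`. -/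
def χb : ContDiffBump (0 : ℝ³) := ⟨4, 5, by norm_num, by norm_num⟩

/-- `ρ² = x₀² + x₁²`. -/
def ρ2 (x : ℝ³) : ℝ := x 0 * x 0 + x 1 * x 1

/-- The swirl amplitude as a function of `(ρ², x₂)`: `e^{(1 − ρ²)/2} χ₁(ρ²) β₀(x₂)`. -/
def Fprof (p : ℝ × ℝ) : ℝ := Real.exp ((1 - p.1) / 2) * χ1 p.1 * β0 p.2

/-- `x ↦ (ρ², x₂)`. -/
def qmap (x : ℝ³) : ℝ × ℝ := (ρ2 x, x 2)

/-- The swirl amplitude `f(x) = e^{(1 − ρ²)/2} χ₁(ρ²) β₀(x₂)` (axisymmetric about the `x₂`-axis). -/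
def famp (x : ℝ³) : ℝ := Fprof (qmap x)

/-- **The swirl** `v_sw(x) = f(x) J x`: smooth, compactly supported, divergence free, `|v_sw| ≤ 1`
with equality exactly tangentially along the unit circle `γ₁`. -/
def vSwirl (x : ℝ³) : ℝ³ := famp x • Jrot x

/-- The strain potential `φ = ½(−x₀² − x₁² + 2x₂²)` (harmonic), `∇φ = S x`. -/
def φpot (x : ℝ³) : ℝ := x 2 * x 2 - (x 0 * x 0 + x 1 * x 1) * 2⁻¹

/-- The vector potential `Ψ₀ = (−x₁x₂, x₀x₂, 0)` of the strain: `curl Ψ₀ = S x`. -/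
def Ψ0 (x : ℝ³) : ℝ³ := (-(x 1 * x 2)) • e0 + (x 0 * x 2) • e1

/-- The potential localised by `χ_b`. -/
def Ψloc (x : ℝ³) : ℝ³ := χb x • Ψ0 x

/-- **The localised Burgers strain** `w = curl (χ_b Ψ₀)`: smooth, compactly supported, divergence
free, and equal to the linear strain `S x = (−x₀, −x₁, 2x₂)` on the ball `‖x‖ < 4`. -/
def wStr : ℝ³ → ℝ³ := curl Ψloc

/-- The localised scalar potential `ψ = χ_b φ`. -/
def ψpot (x : ℝ³) : ℝ := χb x * φpot x

/-- The residual `m = w − ∇ψ`, supported in the shell `4 ≤ ‖x‖ ≤ 5` (away from the swirl). -/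
def mRes (x : ℝ³) : ℝ³ := wStr x - gradient ψpot x

/-- **The profile** `V_δ = v_sw + δ w`. -/
def vW (δ : ℝ) : ℝ³ → ℝ³ := vSwirl + δ • wStr

/-! ### Smoothness -/

/-- Coordinates are smooth. -/
theorem contDiff_coord (i : Fin 3) : ContDiff ℝ ∞ fun x : ℝ³ => x i :=
  contDiff_piLp_apply (p := 2) (i := i)

/-- `ρ²` is smooth. -/
theorem contDiff_ρ2 : ContDiff ℝ ∞ ρ2 :=
  ((contDiff_coord 0).mul (contDiff_coord 0)).add ((contDiff_coord 1).mul (contDiff_coord 1))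

/-- The amplitude profile is smooth. -/
theorem contDiff_Fprof : ContDiff ℝ ∞ Fprof :=
  ((Real.contDiff_exp.comp ((contDiff_const.sub contDiff_fst).div_const 2)).mul
    (χ1.contDiff.comp contDiff_fst)).mul (β0.contDiff.comp contDiff_snd)

/-- `x ↦ (ρ², x₂)` is smooth. -/
theorem contDiff_qmap : ContDiff ℝ ∞ qmap := contDiff_ρ2.prodMk (contDiff_coord 2)

/-- The swirl amplitude is smooth. -/
theorem contDiff_famp : ContDiff ℝ ∞ famp := contDiff_Fprof.comp contDiff_qmap

/-- The swirl is smooth. -/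
theorem contDiff_vSwirl : ContDiff ℝ ∞ vSwirl := contDiff_famp.smul Jrot.contDiff

/-- The strain potential is smooth. -/
theorem contDiff_φpot : ContDiff ℝ ∞ φpot :=
  ((contDiff_coord 2).mul (contDiff_coord 2)).sub
    ((((contDiff_coord 0).mul (contDiff_coord 0)).add ((contDiff_coord 1).mul (contDiff_coord 1))).mul
      contDiff_const)

/-- The vector potential is smooth. -/
theorem contDiff_Ψ0 : ContDiff ℝ ∞ Ψ0 :=
  (((contDiff_coord 1).mul (contDiff_coord 2)).neg.smul contDiff_const).add
    (((contDiff_coord 0).mul (contDiff_coord 2)).smul contDiff_const)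

/-- The localised vector potential is smooth. -/
theorem contDiff_Ψloc : ContDiff ℝ ∞ Ψloc := χb.contDiff.smul contDiff_Ψ0

/-- The localised strain is smooth. -/
theorem contDiff_wStr : ContDiff ℝ ∞ wStr :=
  contDiff_curl (n := ⊤) (contDiff_Ψloc.of_le (by exact_mod_cast le_top))

/-- The localised scalar potential is smooth. -/
theorem contDiff_ψpot : ContDiff ℝ ∞ ψpot := χb.contDiff.mul contDiff_φpot

/-- The profile is smooth. -/
theorem contDiff_vW (δ : ℝ) : ContDiff ℝ ∞ (vW δ) :=
  contDiff_vSwirl.add (contDiff_const.smul contDiff_wStr)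

/-! ### The swirl is divergence free (its amplitude is constant along the rotation field) -/

/-- `Df(x)[J x] = 0`: `f` factors through `(ρ², x₂)`, and `J x` is tangent to their level sets. -/
theorem fderiv_famp_Jrot (x : ℝ³) : fderiv ℝ famp x (Jrot x) = 0 := by
  have h0 : HasFDerivAt (fun y : ℝ³ => y 0) (EuclideanSpace.proj 0 : ℝ³ →L[ℝ] ℝ) x :=
    PiLp.hasFDerivAt_apply 2 x 0
  have h1 : HasFDerivAt (fun y : ℝ³ => y 1) (EuclideanSpace.proj 1 : ℝ³ →L[ℝ] ℝ) x :=
    PiLp.hasFDerivAt_apply 2 x 1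
  have h2 : HasFDerivAt (fun y : ℝ³ => y 2) (EuclideanSpace.proj 2 : ℝ³ →L[ℝ] ℝ) x :=
    PiLp.hasFDerivAt_apply 2 x 2
  have hq : HasFDerivAt qmap
      (((x 0 • (EuclideanSpace.proj 0 : ℝ³ →L[ℝ] ℝ) + x 0 • (EuclideanSpace.proj 0 : ℝ³ →L[ℝ] ℝ)) +
        (x 1 • (EuclideanSpace.proj 1 : ℝ³ →L[ℝ] ℝ) + x 1 • (EuclideanSpace.proj 1 : ℝ³ →L[ℝ] ℝ))).prod
        (EuclideanSpace.proj 2 : ℝ³ →L[ℝ] ℝ)) x :=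
    ((h0.mul h0).add (h1.mul h1)).prodMk h2
  have hF : DifferentiableAt ℝ Fprof (qmap x) := (contDiff_Fprof.differentiable (by simp)) _
  show fderiv ℝ (Fprof ∘ qmap) x (Jrot x) = 0
  rw [fderiv_comp x hF hq.differentiableAt, hq.fderiv]
  simp only [ContinuousLinearMap.coe_comp, Function.comp_apply]
  have hzero : (((x 0 • (EuclideanSpace.proj 0 : ℝ³ →L[ℝ] ℝ) + x 0 • (EuclideanSpace.proj 0 : ℝ³ →L[ℝ] ℝ)) +
        (x 1 • (EuclideanSpace.proj 1 : ℝ³ →L[ℝ] ℝ) + x 1 • (EuclideanSpace.proj 1 : ℝ³ →L[ℝ] ℝ))).prod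
        (EuclideanSpace.proj 2 : ℝ³ →L[ℝ] ℝ)) (Jrot x) = 0 := by
    rw [ContinuousLinearMap.prod_apply, Prod.mk_eq_zero]
    constructor
    · simp only [add_apply, FunLike.coe_smul, Pi.smul_apply,
        smul_eq_mul, PiLp.proj_apply, Jrot_apply_zero, Jrot_apply_one]
      ring
    · simp [PiLp.proj_apply]
  rw [hzero, map_zero]

/-- **`div v_sw = 0`.** -/
theorem divergence_vSwirl (x : ℝ³) : VectorCalculus.divergence vSwirl x = 0 := by
  have hf : DifferentiableAt ℝ famp x := (contDiff_famp.differentiable (by simp)) x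
  have hD : fderiv ℝ vSwirl x = famp x • Jrot + (fderiv ℝ famp x).smulRight (Jrot x) := by
    show fderiv ℝ (fun y => famp y • Jrot y) x = _
    rw [fderiv_fun_smul hf Jrot.differentiableAt, ContinuousLinearMap.fderiv]
  rw [divergence_eq_sum_inner_fderiv (EuclideanSpace.basisFun (Fin 3) ℝ), hD]
  have key : fderiv ℝ famp x (Jrot x) = 0 := fderiv_famp_Jrot x
  rw [Jrot_eq x, map_add, map_smul, map_smul] at key
  simp only [Fin.sum_univ_three, EuclideanSpace.basisFun_apply, add_apply,
    FunLike.coe_smul, Pi.smul_apply, ContinuousLinearMap.smulRight_apply,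
    inner_add_right, EuclideanSpace.inner_single_left, map_one, one_mul]
  simp only [smul_eq_mul, e0, e1] at key
  simp
  linarith [key]

/-- The swirl is divergence free. -/
theorem isDivFree_vSwirl : VectorCalculus.IsDivFree vSwirl := divergence_vSwirl

/-- `div w = div curl (χ_b Ψ₀) = 0`. -/
theorem isDivFree_wStr : VectorCalculus.IsDivFree wStr := fun x =>
  divergence_curl_eq_zero_holds Ψloc (contDiff_infty.1 contDiff_Ψloc 2) x

/-- **`div V_δ = 0`.** -/
theorem isDivFree_vW (δ : ℝ) : VectorCalculus.IsDivFree (vW δ) := by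
  intro x
  have h1 : DifferentiableAt ℝ vSwirl x := (contDiff_vSwirl.differentiable (by simp)) x
  have h2 : DifferentiableAt ℝ wStr x := (contDiff_wStr.differentiable (by simp)) x
  unfold VectorCalculus.divergence
  rw [vW, fderiv_add h1 (h2.const_smul δ), fderiv_const_smul h2]
  have e1' := isDivFree_vSwirl x
  have e2' := isDivFree_wStr x
  unfold VectorCalculus.divergence at e1' e2'
  simp [e1', e2']

/-! ### The strain: `curl Ψ₀ = ∇φ = S` and the localisation -/

/-- `curl Ψ₀ = S`. -/
theorem curl_Ψ0 (x : ℝ³) : curl Ψ0 x = Sst x := by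
  have h0 : HasFDerivAt (fun y : ℝ³ => y 0) (EuclideanSpace.proj 0 : ℝ³ →L[ℝ] ℝ) x :=
    PiLp.hasFDerivAt_apply 2 x 0
  have h1 : HasFDerivAt (fun y : ℝ³ => y 1) (EuclideanSpace.proj 1 : ℝ³ →L[ℝ] ℝ) x :=
    PiLp.hasFDerivAt_apply 2 x 1
  have h2 : HasFDerivAt (fun y : ℝ³ => y 2) (EuclideanSpace.proj 2 : ℝ³ →L[ℝ] ℝ) x :=
    PiLp.hasFDerivAt_apply 2 x 2
  have hΨ : HasFDerivAt Ψ0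
      ((-(x 1 • (EuclideanSpace.proj 2 : ℝ³ →L[ℝ] ℝ) + x 2 • (EuclideanSpace.proj 1 : ℝ³ →L[ℝ] ℝ))).smulRight e0 +
        (x 0 • (EuclideanSpace.proj 2 : ℝ³ →L[ℝ] ℝ) + x 2 • (EuclideanSpace.proj 0 : ℝ³ →L[ℝ] ℝ)).smulRight e1) x :=
    ((h1.mul h2).neg.smul_const e0).add ((h0.mul h2).smul_const e1)
  rw [curl, hΨ.fderiv]
  ext i
  fin_cases i <;> simp [e0, e1, PiLp.proj_apply]
  ring

/-- `∇φ = S`. -/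
theorem hasFDerivAt_φpot (x : ℝ³) :
    HasFDerivAt φpot (InnerProductSpace.toDual ℝ ℝ³ (Sst x)) x := by
  have h0 : HasFDerivAt (fun y : ℝ³ => y 0) (EuclideanSpace.proj 0 : ℝ³ →L[ℝ] ℝ) x :=
    PiLp.hasFDerivAt_apply 2 x 0
  have h1 : HasFDerivAt (fun y : ℝ³ => y 1) (EuclideanSpace.proj 1 : ℝ³ →L[ℝ] ℝ) x :=
    PiLp.hasFDerivAt_apply 2 x 1
  have h2 : HasFDerivAt (fun y : ℝ³ => y 2) (EuclideanSpace.proj 2 : ℝ³ →L[ℝ] ℝ) x :=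
    PiLp.hasFDerivAt_apply 2 x 2
  have h : HasFDerivAt φpot
      ((x 2 • (EuclideanSpace.proj 2 : ℝ³ →L[ℝ] ℝ) + x 2 • (EuclideanSpace.proj 2 : ℝ³ →L[ℝ] ℝ)) -
        (2⁻¹ : ℝ) • ((x 0 • (EuclideanSpace.proj 0 : ℝ³ →L[ℝ] ℝ) + x 0 • (EuclideanSpace.proj 0 : ℝ³ →L[ℝ] ℝ)) +
          (x 1 • (EuclideanSpace.proj 1 : ℝ³ →L[ℝ] ℝ) + x 1 • (EuclideanSpace.proj 1 : ℝ³ →L[ℝ] ℝ)))) x :=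
    (h2.mul h2).sub (((h0.mul h0).add (h1.mul h1)).mul_const (2⁻¹ : ℝ))
  refine h.congr_fderiv (ContinuousLinearMap.ext fun y => ?_)
  simp only [InnerProductSpace.toDual_apply_apply, PiLp.inner_apply, Fin.sum_univ_three,
    RCLike.inner_apply, conj_trivial, Sst_apply_zero, Sst_apply_one, Sst_apply_two,
    add_apply, sub_apply, FunLike.coe_smul, Pi.smul_apply, smul_eq_mul, PiLp.proj_apply]
  ring

/-- `∇φ = S`. -/
theorem gradient_φpot (x : ℝ³) : gradient φpot x = Sst x :=
  (hasGradientAt_iff_hasFDerivAt.mpr (hasFDerivAt_φpot x)).gradient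

/-- `χ_b = 1` on the closed ball of radius `4`. -/
theorem χb_eq_one {x : ℝ³} (hx : ‖x‖ ≤ 4) : χb x = 1 :=
  χb.one_of_mem_closedBall (by simpa [χb] using hx)

/-- On the ball `‖x‖ < 4` the localised strain is the linear strain: `w = S`. -/
theorem wStr_eq_Sst {x : ℝ³} (hx : ‖x‖ < 4) : wStr x = Sst x := by
  have hev : Ψloc =ᶠ[𝓝 x] Ψ0 := by
    filter_upwards [isOpen_ball.mem_nhds (mem_ball_zero_iff.2 hx)] with y hy
    rw [Ψloc, χb_eq_one (le_of_lt (mem_ball_zero_iff.1 hy)), one_smul]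
  rw [wStr, curl_eq_curlCLM, hev.fderiv_eq, ← curl_eq_curlCLM, curl_Ψ0]

/-- Near a point of the ball `‖x‖ < 4` the localised strain agrees with `S`. -/
theorem wStr_eventuallyEq {x : ℝ³} (hx : ‖x‖ < 4) : wStr =ᶠ[𝓝 x] (⇑Sst) := by
  filter_upwards [isOpen_ball.mem_nhds (mem_ball_zero_iff.2 hx)] with y hy
  exact wStr_eq_Sst (mem_ball_zero_iff.1 hy)

/-- On the ball `‖x‖ < 4`: `Dw = S`. -/
theorem fderiv_wStr {x : ℝ³} (hx : ‖x‖ < 4) : fderiv ℝ wStr x = Sst := by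
  rw [(wStr_eventuallyEq hx).fderiv_eq, ContinuousLinearMap.fderiv]

/-- On the ball `‖x‖ < 4`: `∇ψ = ∇φ = S`. -/
theorem gradient_ψpot {x : ℝ³} (hx : ‖x‖ < 4) : gradient ψpot x = Sst x := by
  have hev : ψpot =ᶠ[𝓝 x] φpot := by
    filter_upwards [isOpen_ball.mem_nhds (mem_ball_zero_iff.2 hx)] with y hy
    rw [ψpot, χb_eq_one (le_of_lt (mem_ball_zero_iff.1 hy)), one_mul]
  unfold gradient
  rw [hev.fderiv_eq]
  exact gradient_φpot x

/-- The residual vanishes on the ball `‖x‖ < 4` (in particular near the swirl). -/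
theorem mRes_eq_zero {x : ℝ³} (hx : ‖x‖ < 4) : mRes x = 0 := by
  rw [mRes, wStr_eq_Sst hx, gradient_ψpot hx, sub_self]

end Summit.NavierStokesRegularity.NavierStokesRegularity.Theorems.TautCompressionIntegrable.Negative

end
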